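import Summits.QuantumFields.BalabanUV.Beta.FP.TorusCompositeCovarianceOne

/-!
# `BalabanUV.Beta.FP.TorusStepInsertionPeriodic` — road «FP» for binder row D1, ROUTE T: **THE ONE-STEP INSERTION JET `stepIns₁` ACTS ON PERIODIC 1-FORMS AS
# an1's ROOTED FIELD–MULTIPLIER KERNEL `vhKerAt`** — the order-1 twin of `FP/TorusCompositeRowsPeriodic.sum_Qstep_mul_periodic` (the (C1) chart-side junction,
# one step, first order; MEMO-g27-hQ-junction §4 (i))

WHY.  The composite first-order insertion jet of the tower (`TorusCompositeCovarianceOne.compIns₁`, our ♭ bookkeeping by the chain rule `compIns₁_succ`) is built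
from the ONE-STEP jet `stepIns₁ M Lc r w = Σ_b w b • (perF (fine Lc M) (dper (fine Lc M) (vhSAt (toSite r) d Lc rfl b.2 b.1))).submatrix ((coarsePt, inr), (·, inl))`
— an1's rooted field–multiplier stencil family `vhSAt (toSite r) = packVH vhKerAt` inserted along a torus bond weight `w`, diagonally periodised (`dper`) and
periodised (`perF`).  The (S3-2) namings of the OWNER's #41d (`hQF₁ : Q₁₁f (dv k) = VF.submatrix fF (ff)`, `VF := perF T (dper T (𝒱_F μ 0))`) identify this torus
jet with a LATTICE first-variation table of the composite averaging (an2's (C1) TABLES, `Beta/CompositeFirstOrderTables`); whatever packaging the row chooses, the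
junction passes through the entry unfolding typed here, because `stepIns₁` is hard-wired to `vhSAt (toSite r)`.  THIS FILE is that unfolding, chart-free and
packaging-free (no `def`): the action of `stepIns₁` on `fine Lc M`-periodic real 1-forms, written in an1's `vhKerAt` BY NAME.

WHAT (generic `d`; box `M`, blocking `Lc`, fine torus `fine Lc M`; root `r ∈ box (d+1) Lc`).
* §1 `sum_perZ_mul_periodic` — TORUS PAIRING WITH A PERIODIC FORM = LATTICE PAIRING: for a kernel `K` whose `(inr μ, inl l)` entries at the first slot `x` are
  summable against the form (e.g. finitely supported in the fluctuation slot) and an `M`-periodic form `B`,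
  `Σ_{y ∈ pbox M} Σ_l perZ M K x y (inr μ) (inl l) · B l y = Σ'_z Σ_l K x z (inr μ) (inl l) · B l z` (the form twin of g17 `PeriodisedBorderWardContact.sum_perZ_mul_tgrad`;
  the pattern of `TorusCompositeRowsPeriodic.sum_perZ_bhKAt_mul_periodic` for a generic kernel).
* §2 ONE BACKGROUND BOND: `vhSAt_zsmul_inr_inl` (at a coarse multiplier site `Lc•x` the `(inr κ, inl l)` entry of `vhSAt ρ κ′ u` IS `vhKerAt ρ Lc κ x (l,·) (κ′,u)`
  — `packVH_inr_inl`, `off_eq_zero_iff_proj`, `blk_eq_quo`); the support lemmas `summable_vhKerAt_mul`, `tsum_vhKerAt_mul_eq_zero_of_not_mem`; and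
  **`sum_perF_dper_vhSAt_mul_periodic`**: `Σ_{y ∈ pbox (fine Lc M)} Σ_l perF (fine Lc M) (dper (fine Lc M) (vhSAt (toSite r) d Lc rfl κ′ u)) (coarsePt x, inr κ) (y, inl l) · B l y
  = Σ'_m Σ'_z Σ_l vhKerAt (toSite r) Lc κ x (l, z) (κ′, u + (fine Lc M)∘m) · B l z` — the torus insertion at the torus bond `(κ′, u)` is the sum over the
  translated copies of the bond (`PeriodisedBorderTables.dper_apply_of_blockCov` with an1's `vhSAt_translate`), each copy acting on the periodic form as an1's kernel.
* §3 THE WEIGHTED SUM: **`sum_stepIns₁_mul_periodic_eq_sum_bonds`** (`Σ_q stepIns₁ M Lc r w (x,κ) q · B q.2 q.1 = Σ_b w b · Σ'_m Σ'_z Σ_l vhKerAt … (l,z) (b.2, b.1 + T∘m) · B l z`)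
  and **`sum_stepIns₁_mul_periodic`** — THE PERIODIC LIFT: with `W κ′ u := w (wrapPt (fine Lc M) u, κ′)` the `fine Lc M`-periodic lift of the weight,
  `Σ_q stepIns₁ M Lc r w (x,κ) q · B q.2 q.1 = Σ'_u Σ_{κ′} (Σ'_z Σ_l vhKerAt (toSite r) Lc κ x (l,z) (κ′,u) · B l z) · w (wrapPt (fine Lc M) u, κ′)` —
  `stepIns₁ w` acts on periodic forms as an1's rooted field–multiplier kernel of the coarse bond `(κ, x)` summed against (the form in the fluctuation bond, the
  periodic lift of the weight in the background bond); all sums are finitely supported (`vhKerAt_eq_zero_left ∕ _right`: both bonds in an1's box `Near Lc x`).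
NOT HERE: the composite induction (`compIns₁ … (n+1) h` on `towerTorus`-periodic forms — TOP-PEEL `compIns₁_succ`, §3 at the top on the transported direction
`compRows′ *ᵥ h` whose lift is `S′ • compLinAvgAt r Lc n (lift h)` by `TorusCompositeRowsPeriodic.sum_compRows_mul_periodic`, plus `sum_Qstep_mul_periodic` on the
lower functional): it names the row's lattice composite first-variation functional and waits for an2's literal (unit placement, `r ↔ rs` dictionary); the
second order (`stepIns₂ ∕ compIns₂₂`, an1's third tables); any `perF` packaging; any chart; any estimate.

[folklore] finite sums + finitely supported `tsum` re-indexing BY NAME over OUR bookkeeping objects (`stepIns₁`, `perF ∕ perZ ∕ dper`, `coarsePt ∕ wrapPt ∕ nearBox`)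
and an1's typed tables (`vhSAt = packVH vhKerAt`, `vhKerAt`, `vhSAt_translate`, `vhKerAt_eq_zero_left ∕ _right`); no `def`, no `def … : Prop`, nothing cited,
0 sorry.  Nothing of the dictionary ∕ Bałaban's non-linear averages asserted beyond their typed linearisations (that the composite's first variation IS this chain
of one-step tables is an2's (C1) TABLE word, R-D1-g42-4); NO chart fixed; the (C1) TABLES, the seven letters, `hH ∕ hQ` untouched.

HONEST DEPENDENCY (page 1, mandatory): continuum YM on T⁴ ⇐ BetaPertH ∧ nine spine estimates (0/9 proved); BetaPertH ⇐ (D1) ∧ (D4) ∧ CAP+tail;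
G-an2-4 gates asym, D1 and NE2/3/4.  HONEST FRAMING (cell contract, verbatim): «discharging `BetaPertH` makes Bałaban's UV stability UNCONDITIONAL —
a real constructive-QFT result; it is NOT the continuum limit and NOT the Clay problem.»  ABSOLUTE RULE (cell charter, verbatim): «No internally-minted
statement may enter as a cited fact. Every hypothesis is either kernel-proved in this package or a verbatim quotation of a PUBLISHED theorem with page
reference. The manuscript(s) under audit are NOT citable for their own disputed steps — they are the thing under adjudication; programme-internal
(2001/route/tribunal) claims are never citable.»  0 estimates; 0∕4 row-D1 binders (hW, hR, D1Tel, D1Rep); NOT (T-ID), NOT (C1), NOT SDF, NOT D1,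
NOT BetaPertH, NOT continuum, NOT Clay.  D1 formalisation swarm LEAF PROVER 02 (b2b-balaban-beta-d1-formalise-leaf-02 gen 28), 2026-08-23.  No existing file touched.
-/

noncomputable section

open scoped BigOperators

namespace Summit.QuantumFields.BalabanUV.Beta.FP.TorusStepInsertionPeriodic

open Matrix Finset
open Literature.Probability.LatticeModels (Torus.proj)
open Literature.MathematicalPhysics.QuantumFieldTheory
open Literature.MathematicalPhysics.QuantumFieldTheory.Balaban1983to89
open Literature.MathematicalPhysics.QuantumFieldTheory.Balaban1983to89.Beta
open B5Prop11Plancherel (fine)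
open B6Lemma24Torus (pbox mem_pbox wrap)
open B4TorusKernel.MultiPeriod (translate translate_apply translate_injective)
open Summit.QuantumFields.BalabanUV.Beta.GAN24.DirichletExhaustionPeriodise (one_le_M)
open ExpKernelCalculus (MKer)
open AffineAveraging (Site Form1 box toSite)
open AveragingContours (off blk)
open AveragingHessianKernels (Bond Near packVH_inr_inl)
open AveragingHessianKernelsRooted (vhSAt vhSAt_translate vhKerAt vhKerAt_eq_zero_left vhKerAt_eq_zero_right)
open OneStepResolventKernel (Fib proj_zsmul quo_zsmul)
open LatticeForm (quo)
open Summit.QuantumFields.BalabanUV.Beta.BorderedHessian (off_eq_zero_iff_proj blk_eq_quo)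
open Summit.QuantumFields.BalabanUV.Beta.GAN24.KernelPeriodisation (wrap_translate)
open Summit.QuantumFields.BalabanUV.Beta.FP.KernelPeriodisationFib (Idx perF perF_apply perZ perZ_apply)
open Summit.QuantumFields.BalabanUV.Beta.FP.KernelPeriodisationFibLoc (dper dper_apply)
open Summit.QuantumFields.BalabanUV.Beta.FP.KernelPeriodisationFibTrace (tsum_sites_eq_sum_tsum)
open Summit.QuantumFields.BalabanUV.Beta.FP.PeriodisedBorderTables (dper_apply_of_blockCov)
open Summit.QuantumFields.BalabanUV.Beta.FP.TorusGaugeCovariance (nearBox mem_nearBox)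
open Summit.QuantumFields.BalabanUV.Beta.FP.TorusGaugeCovariancePairing (wrapPt wrapPt_coe wrapPt_of_mem)
open Summit.QuantumFields.BalabanUV.Beta.FP.TorusGaugeCovarianceCoarse (coarsePt coarsePt_coe)
open Summit.QuantumFields.BalabanUV.Beta.FP.TorusCompositeCovarianceOne (stepIns₁)

variable {d : ℕ}

/-! ## §1 Torus pairing with a periodic form = lattice pairing -/

section Pairing

variable (M : Fin (d + 1) → ℕ) [∀ μ, NeZero (M μ)]

/-- [folklore] **`sum_perZ_mul_periodic` — THE TORUS PAIRING WITH A PERIODIC FORM IS THE LATTICE PAIRING**: for a kernel `K` whose `(inr μ, inl l)` entries at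
the first slot `x` are summable against the `M`-periodic real 1-form `B` (e.g. finitely supported in the fluctuation slot),
`Σ_{y ∈ pbox M} Σ_l perZ M K x y (inr μ) (inl l) · B l y = Σ'_z Σ_l K x z (inr μ) (inl l) · B l z` (box × period lattice = lattice, `tsum_sites_eq_sum_tsum`). -/
theorem sum_perZ_mul_periodic (K : MKer (d + 1) (Fib d)) (x : Site (d + 1)) (μ : Fin (d + 1)) (B : Form1 (d + 1) ℝ)
    (hB : ∀ (l : Fin (d + 1)) (y m : Site (d + 1)), B l (translate M y m) = B l y)
    (hK : ∀ l : Fin (d + 1), Summable fun z => K x z (Sum.inr μ) (Sum.inl l) * B l z) :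
    ∑ y : ↥(pbox M), ∑ l : Fin (d + 1), perZ M K x (y : Site (d + 1)) (Sum.inr μ) (Sum.inl l) * B l (y : Site (d + 1))
      = ∑' z : Site (d + 1), ∑ l : Fin (d + 1), K x z (Sum.inr μ) (Sum.inl l) * B l z := by
  set H : Fin (d + 1) → Site (d + 1) → ℝ := fun l z => K x z (Sum.inr μ) (Sum.inl l) * B l z with hH
  have hterm : ∀ (y : ↥(pbox M)) (l : Fin (d + 1)),
      perZ M K x (y : Site (d + 1)) (Sum.inr μ) (Sum.inl l) * B l (y : Site (d + 1))
        = ∑' m : Site (d + 1), H l (translate M (y : Site (d + 1)) m) := fun y l => by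
    rw [perZ_apply, ← tsum_mul_right]
    refine tsum_congr fun m => ?_
    simp only [hH]
    rw [hB]
  calc ∑ y : ↥(pbox M), ∑ l : Fin (d + 1), perZ M K x (y : Site (d + 1)) (Sum.inr μ) (Sum.inl l) * B l (y : Site (d + 1))
      = ∑ y : ↥(pbox M), ∑ l : Fin (d + 1), ∑' m : Site (d + 1), H l (translate M (y : Site (d + 1)) m) :=
        Finset.sum_congr rfl fun y _ => Finset.sum_congr rfl fun l _ => hterm y l
    _ = ∑ l : Fin (d + 1), ∑ y : ↥(pbox M), ∑' m : Site (d + 1), H l (translate M (y : Site (d + 1)) m) := Finset.sum_comm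
    _ = ∑ l : Fin (d + 1), ∑' z : Site (d + 1), H l z := Finset.sum_congr rfl fun l _ => (tsum_sites_eq_sum_tsum M (hK l)).symm
    _ = ∑' z : Site (d + 1), ∑ l : Fin (d + 1), H l z := (Summable.tsum_finsetSum fun l _ => hK l).symm

/-- [folklore] a lattice function vanishing off a finite set, read along the translates of a point, vanishes off a finite set of translation indices
(so its sum over the period lattice is a finite sum; `translate_injective`). -/
theorem exists_finset_translate (S : Finset (Site (d + 1))) (y : Site (d + 1)) :
    ∃ F : Finset (Site (d + 1)), ∀ m ∉ F, translate M y m ∉ S := by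
  classical
  refine ⟨S.preimage (fun m => translate M y m) (translate_injective (one_le_M M) y).injOn, fun m hm h => hm ?_⟩
  exact Finset.mem_preimage.2 h

end Pairing

/-! ## §2 One background bond: the torus insertion of an1's rooted table acts on periodic forms as `vhKerAt`, copy by copy -/

section Bond

variable (M : Fin (d + 1) → ℕ) [∀ μ, NeZero (M μ)] (Lc : ℕ) [NeZero Lc] {r : Fin (d + 1) → ℕ}

omit [NeZero Lc] in
/-- [folklore] **AT A COARSE MULTIPLIER SITE THE `(inr, inl)` ENTRY OF an1's ROOTED TABLE IS an1's KERNEL**: for any root `ρ`, background bond `(κ′, u)`, coarse point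
`x` and fluctuation bond `(l, z)`, `vhSAt ρ d Lc rfl κ′ u (Lc•x) z (inr κ) (inl l) = vhKerAt ρ Lc κ x (l, z) (κ′, u)` (`packVH_inr_inl` at `off Lc (Lc•x) = 0`, `blk Lc (Lc•x) = x`). -/
theorem vhSAt_zsmul_inr_inl [NeZero Lc] (ρ : Site (d + 1)) (κ' : Fin (d + 1)) (u : Site (d + 1)) (x z : Site (d + 1)) (κ l : Fin (d + 1)) :
    vhSAt ρ d Lc rfl κ' u ((Lc : ℤ) • x) z (Sum.inr κ) (Sum.inl l) = vhKerAt ρ Lc κ x (l, z) (κ', u) := by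
  simp only [vhSAt, packVH_inr_inl]
  rw [if_pos ((off_eq_zero_iff_proj _).2 (proj_zsmul (N := Lc) x)), blk_eq_quo, quo_zsmul (N := Lc)]

omit [NeZero Lc] in
/-- [folklore] an1's kernel is finitely supported in the fluctuation bond (box root: `vhKerAt_eq_zero_left`), hence summable against any lattice function. -/
theorem summable_vhKerAt_mul (hr : r ∈ box (d + 1) Lc) (κ : Fin (d + 1)) (x : Site (d + 1)) (l : Fin (d + 1)) (f' : Bond (d + 1))
    (g : Site (d + 1) → ℝ) : Summable fun z : Site (d + 1) => vhKerAt (toSite r) Lc κ x (l, z) f' * g z :=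
  summable_of_ne_finset_zero (s := nearBox Lc x) fun z hz => by
    rw [vhKerAt_eq_zero_left hr (f := (l, z)) (fun h => hz (mem_nearBox.2 h)) f', zero_mul]

omit [NeZero Lc] in
/-- [folklore] … and the finite sum over the fluctuation directions is summable in the fluctuation site. -/
theorem summable_sum_vhKerAt_mul (hr : r ∈ box (d + 1) Lc) (κ : Fin (d + 1)) (x : Site (d + 1)) (f' : Bond (d + 1)) (B : Form1 (d + 1) ℝ) :
    Summable fun z : Site (d + 1) => ∑ l : Fin (d + 1), vhKerAt (toSite r) Lc κ x (l, z) f' * B l z :=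
  summable_sum fun l _ => summable_vhKerAt_mul Lc hr κ x l f' (B l)

omit [NeZero Lc] in
/-- [folklore] an1's kernel is finitely supported in the BACKGROUND bond too (`vhKerAt_eq_zero_right`): the lattice pairing with any form vanishes when the
background bond's base is off an1's box `Near Lc x`. -/
theorem tsum_vhKerAt_mul_eq_zero_of_not_mem (hr : r ∈ box (d + 1) Lc) (κ : Fin (d + 1)) (x : Site (d + 1)) {f' : Bond (d + 1)}
    (hf' : f'.2 ∉ nearBox Lc x) (B : Form1 (d + 1) ℝ) :
    ∑' z : Site (d + 1), ∑ l : Fin (d + 1), vhKerAt (toSite r) Lc κ x (l, z) f' * B l z = 0 := by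
  refine (tsum_congr fun z => ?_).trans tsum_zero
  exact Finset.sum_eq_zero fun l _ => by rw [vhKerAt_eq_zero_right hr _ (fun h => hf' (mem_nearBox.2 h)), zero_mul]

/-- [folklore] **`sum_perF_dper_vhSAt_mul_periodic` — THE TORUS INSERTION OF an1's ROOTED TABLE AT ONE TORUS BOND ACTS ON PERIODIC FORMS AS an1's KERNEL, COPY BY
COPY**: for `r ∈ box`, a background bond `(κ′, u)`, a `fine Lc M`-periodic real 1-form `B`, a coarse point `x ∈ pbox M` and a direction `κ`,
`Σ_{y ∈ pbox (fine Lc M)} Σ_l perF (fine Lc M) (dper (fine Lc M) (vhSAt (toSite r) d Lc rfl κ′ u)) (coarsePt x, inr κ) (y, inl l) · B l y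
 = Σ'_m Σ'_z Σ_l vhKerAt (toSite r) Lc κ x (l, z) (κ′, u + (fine Lc M)∘m) · B l z`
(`dper_apply_of_blockCov` with `vhSAt_translate`: the insertion is the sum over the translated copies of the bond; §1; `vhSAt_zsmul_inr_inl`; every sum finite). -/
theorem sum_perF_dper_vhSAt_mul_periodic (hr : r ∈ box (d + 1) Lc) (κ' : Fin (d + 1)) (u : Site (d + 1)) (B : Form1 (d + 1) ℝ)
    (hB : ∀ (l : Fin (d + 1)) (y m : Site (d + 1)), B l (translate (fine Lc M) y m) = B l y) (x : ↥(pbox M)) (κ : Fin (d + 1)) :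
    ∑ y : ↥(pbox (fine Lc M)), ∑ l : Fin (d + 1),
        perF (fine Lc M) (dper (fine Lc M) (vhSAt (toSite r) d Lc rfl κ' u)) (coarsePt M Lc x, Sum.inr κ) (y, Sum.inl l) * B l (y : Site (d + 1))
      = ∑' m : Site (d + 1), ∑' z : Site (d + 1), ∑ l : Fin (d + 1),
          vhKerAt (toSite r) Lc κ (x : Site (d + 1)) (l, z) (κ', translate (fine Lc M) u m) * B l z := by
  have hL : 1 ≤ Lc := Nat.one_le_iff_ne_zero.mpr (NeZero.ne Lc)
  have hM : ∀ i, fine Lc M i = Lc * M i := fun i => rfl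
  -- the copies of the bond loading the block of `x` are finitely many
  obtain ⟨F, hF⟩ := exists_finset_translate (fine Lc M) (nearBox Lc (x : Site (d + 1))) u
  -- entry unfolding at the coarse multiplier site
  have hV : ∀ (m z : Site (d + 1)) (l : Fin (d + 1)),
      vhSAt (toSite r) d Lc rfl κ' (translate (fine Lc M) u m) ((coarsePt M Lc x : ↥(pbox (fine Lc M))) : Site (d + 1)) z (Sum.inr κ) (Sum.inl l)
        = vhKerAt (toSite r) Lc κ (x : Site (d + 1)) (l, z) (κ', translate (fine Lc M) u m) := fun m z l => by
    rw [coarsePt_coe]; exact vhSAt_zsmul_inr_inl Lc _ _ _ _ _ _ _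
  -- the diagonally periodised table, entrywise, as a FINITE sum over those copies
  have hdper : ∀ (z : Site (d + 1)) (l : Fin (d + 1)),
      dper (fine Lc M) (vhSAt (toSite r) d Lc rfl κ' u) ((coarsePt M Lc x : ↥(pbox (fine Lc M))) : Site (d + 1)) z (Sum.inr κ) (Sum.inl l)
        = ∑ m ∈ F, vhKerAt (toSite r) Lc κ (x : Site (d + 1)) (l, z) (κ', translate (fine Lc M) u m) := fun z l => by
    rw [dper_apply_of_blockCov hM (fun κ u t => vhSAt_translate (toSite r) hL κ u t) κ' u]
    rw [tsum_eq_sum (s := F) fun m hm => ?_]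
    · exact Finset.sum_congr rfl fun m _ => hV m z l
    · rw [hV]; exact vhKerAt_eq_zero_right hr _ (fun h => hF m hm (mem_nearBox.2 h))
  -- §1 applies: finite support in the fluctuation slot
  have hK : ∀ l : Fin (d + 1), Summable fun z : Site (d + 1) =>
      dper (fine Lc M) (vhSAt (toSite r) d Lc rfl κ' u) ((coarsePt M Lc x : ↥(pbox (fine Lc M))) : Site (d + 1)) z (Sum.inr κ) (Sum.inl l) * B l z :=
    fun l => summable_of_ne_finset_zero (s := nearBox Lc (x : Site (d + 1))) fun z hz => by
      rw [hdper, Finset.sum_eq_zero fun m _ => vhKerAt_eq_zero_left hr (f := (l, z)) (fun h => hz (mem_nearBox.2 h)) _, zero_mul]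
  calc ∑ y : ↥(pbox (fine Lc M)), ∑ l : Fin (d + 1),
        perF (fine Lc M) (dper (fine Lc M) (vhSAt (toSite r) d Lc rfl κ' u)) (coarsePt M Lc x, Sum.inr κ) (y, Sum.inl l) * B l (y : Site (d + 1))
      = ∑ y : ↥(pbox (fine Lc M)), ∑ l : Fin (d + 1),
          perZ (fine Lc M) (dper (fine Lc M) (vhSAt (toSite r) d Lc rfl κ' u)) ((coarsePt M Lc x : ↥(pbox (fine Lc M))) : Site (d + 1))
            (y : Site (d + 1)) (Sum.inr κ) (Sum.inl l) * B l (y : Site (d + 1)) := by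
        simp only [perF_apply]
    _ = ∑' z : Site (d + 1), ∑ l : Fin (d + 1),
          dper (fine Lc M) (vhSAt (toSite r) d Lc rfl κ' u) ((coarsePt M Lc x : ↥(pbox (fine Lc M))) : Site (d + 1)) z (Sum.inr κ) (Sum.inl l) * B l z :=
        sum_perZ_mul_periodic (fine Lc M) _ _ κ B hB hK
    _ = ∑' z : Site (d + 1), ∑ m ∈ F, ∑ l : Fin (d + 1), vhKerAt (toSite r) Lc κ (x : Site (d + 1)) (l, z) (κ', translate (fine Lc M) u m) * B l z := by
        refine tsum_congr fun z => ?_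
        rw [Finset.sum_comm]
        exact Finset.sum_congr rfl fun l _ => by rw [hdper z l, Finset.sum_mul]
    _ = ∑ m ∈ F, ∑' z : Site (d + 1), ∑ l : Fin (d + 1), vhKerAt (toSite r) Lc κ (x : Site (d + 1)) (l, z) (κ', translate (fine Lc M) u m) * B l z :=
        Summable.tsum_finsetSum fun m _ => summable_sum_vhKerAt_mul Lc hr κ _ _ B
    _ = ∑' m : Site (d + 1), ∑' z : Site (d + 1), ∑ l : Fin (d + 1),
          vhKerAt (toSite r) Lc κ (x : Site (d + 1)) (l, z) (κ', translate (fine Lc M) u m) * B l z :=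
        (tsum_eq_sum fun m hm => tsum_vhKerAt_mul_eq_zero_of_not_mem Lc hr κ _ (f' := (κ', translate (fine Lc M) u m)) (hF m hm) B).symm

end Bond

/-! ## §3 The weighted sum: `stepIns₁ w` acts on periodic forms as `vhKerAt` at (the form, the periodic lift of the weight) -/

section Step

variable (M : Fin (d + 1) → ℕ) [∀ μ, NeZero (M μ)] (Lc : ℕ) [NeZero Lc] {r : Fin (d + 1) → ℕ}

/-- [folklore] **`sum_stepIns₁_mul_periodic_eq_sum_bonds` — THE ONE-STEP INSERTION JET ACTS ON PERIODIC FORMS AS an1's KERNEL, BOND BY BOND**: for `r ∈ box`, a torus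
bond weight `w`, a `fine Lc M`-periodic real 1-form `B`, `x ∈ pbox M`, `κ`:
`Σ_q stepIns₁ M Lc r w (x, κ) q · B q.2 q.1 = Σ_b w b · Σ'_m Σ'_z Σ_l vhKerAt (toSite r) Lc κ x (l, z) (b.2, b.1 + (fine Lc M)∘m) · B l z` (unfold `stepIns₁`, §2 per bond). -/
theorem sum_stepIns₁_mul_periodic_eq_sum_bonds (hr : r ∈ box (d + 1) Lc) (w : ↥(pbox (fine Lc M)) × Fin (d + 1) → ℝ) (B : Form1 (d + 1) ℝ)
    (hB : ∀ (l : Fin (d + 1)) (y m : Site (d + 1)), B l (translate (fine Lc M) y m) = B l y) (x : ↥(pbox M)) (κ : Fin (d + 1)) :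
    ∑ q : ↥(pbox (fine Lc M)) × Fin (d + 1), stepIns₁ M Lc r w (x, κ) q * B q.2 (q.1 : Site (d + 1))
      = ∑ b : ↥(pbox (fine Lc M)) × Fin (d + 1), w b *
          ∑' m : Site (d + 1), ∑' z : Site (d + 1), ∑ l : Fin (d + 1),
            vhKerAt (toSite r) Lc κ (x : Site (d + 1)) (l, z) (b.2, translate (fine Lc M) (b.1 : Site (d + 1)) m) * B l z := by
  have hentry : ∀ q : ↥(pbox (fine Lc M)) × Fin (d + 1), stepIns₁ M Lc r w (x, κ) q
      = ∑ b : ↥(pbox (fine Lc M)) × Fin (d + 1), w b *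
          perF (fine Lc M) (dper (fine Lc M) (vhSAt (toSite r) d Lc rfl b.2 (b.1 : Site (d + 1)))) (coarsePt M Lc x, Sum.inr κ) (q.1, Sum.inl q.2) := fun q => by
    rw [stepIns₁, Matrix.sum_apply]
    exact Finset.sum_congr rfl fun b _ => by rw [Matrix.smul_apply, Matrix.submatrix_apply, smul_eq_mul]
  calc ∑ q : ↥(pbox (fine Lc M)) × Fin (d + 1), stepIns₁ M Lc r w (x, κ) q * B q.2 (q.1 : Site (d + 1))
      = ∑ q : ↥(pbox (fine Lc M)) × Fin (d + 1), ∑ b : ↥(pbox (fine Lc M)) × Fin (d + 1), w b *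
          (perF (fine Lc M) (dper (fine Lc M) (vhSAt (toSite r) d Lc rfl b.2 (b.1 : Site (d + 1)))) (coarsePt M Lc x, Sum.inr κ) (q.1, Sum.inl q.2)
            * B q.2 (q.1 : Site (d + 1))) := by
        refine Finset.sum_congr rfl fun q _ => ?_
        rw [hentry, Finset.sum_mul]
        exact Finset.sum_congr rfl fun b _ => mul_assoc _ _ _
    _ = ∑ b : ↥(pbox (fine Lc M)) × Fin (d + 1), w b * ∑ q : ↥(pbox (fine Lc M)) × Fin (d + 1),
          perF (fine Lc M) (dper (fine Lc M) (vhSAt (toSite r) d Lc rfl b.2 (b.1 : Site (d + 1)))) (coarsePt M Lc x, Sum.inr κ) (q.1, Sum.inl q.2)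
            * B q.2 (q.1 : Site (d + 1)) := by
        rw [Finset.sum_comm]
        exact Finset.sum_congr rfl fun b _ => (Finset.mul_sum _ _ _).symm
    _ = _ := by
        refine Finset.sum_congr rfl fun b _ => ?_
        rw [Fintype.sum_prod_type, sum_perF_dper_vhSAt_mul_periodic M Lc hr b.2 (b.1 : Site (d + 1)) B hB x κ]

/-- [folklore] **`sum_stepIns₁_mul_periodic` — THE ONE-STEP INSERTION JET `stepIns₁ w` ACTS ON `fine Lc M`-PERIODIC 1-FORMS AS an1's ROOTED FIELD–MULTIPLIER KERNEL
SUMMED AGAINST (THE FORM, THE PERIODIC LIFT OF THE WEIGHT)**: for `r ∈ box`, a torus bond weight `w` with `fine Lc M`-periodic lift `(κ′, u) ↦ w (wrapPt (fine Lc M) u, κ′)`,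
a `fine Lc M`-periodic real 1-form `B`, `x ∈ pbox M` and `κ`,
`Σ_q stepIns₁ M Lc r w (x, κ) q · B q.2 q.1 = Σ'_u Σ_{κ′} (Σ'_z Σ_l vhKerAt (toSite r) Lc κ x (l, z) (κ′, u) · B l z) · w (wrapPt (fine Lc M) u, κ′)`
— the `stepIns₁` twin of `TorusCompositeRowsPeriodic.sum_Qstep_mul_periodic`; every sum is finite (both bonds lie in an1's box `Near Lc x`). -/
theorem sum_stepIns₁_mul_periodic (hr : r ∈ box (d + 1) Lc) (w : ↥(pbox (fine Lc M)) × Fin (d + 1) → ℝ) (B : Form1 (d + 1) ℝ)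
    (hB : ∀ (l : Fin (d + 1)) (y m : Site (d + 1)), B l (translate (fine Lc M) y m) = B l y) (x : ↥(pbox M)) (κ : Fin (d + 1)) :
    ∑ q : ↥(pbox (fine Lc M)) × Fin (d + 1), stepIns₁ M Lc r w (x, κ) q * B q.2 (q.1 : Site (d + 1))
      = ∑' u : Site (d + 1), ∑ κ' : Fin (d + 1),
          (∑' z : Site (d + 1), ∑ l : Fin (d + 1), vhKerAt (toSite r) Lc κ (x : Site (d + 1)) (l, z) (κ', u) * B l z)
            * w (wrapPt (fine Lc M) u, κ') := by
  -- the lattice functional of the background bond, and its finite support in the bond's base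
  set G : Fin (d + 1) → Site (d + 1) → ℝ := fun κ' u =>
    ∑' z : Site (d + 1), ∑ l : Fin (d + 1), vhKerAt (toSite r) Lc κ (x : Site (d + 1)) (l, z) (κ', u) * B l z with hG
  have hG0 : ∀ (κ' : Fin (d + 1)) (u : Site (d + 1)), u ∉ nearBox Lc (x : Site (d + 1)) → G κ' u = 0 := fun κ' u hu =>
    tsum_vhKerAt_mul_eq_zero_of_not_mem Lc hr κ _ (f' := (κ', u)) hu B
  -- the summand of the right-hand side is finitely supported, hence summable
  have hS : Summable fun u : Site (d + 1) => ∑ κ' : Fin (d + 1), G κ' u * w (wrapPt (fine Lc M) u, κ') :=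
    summable_of_ne_finset_zero (s := nearBox Lc (x : Site (d + 1))) fun u hu =>
      Finset.sum_eq_zero fun κ' _ => by rw [hG0 κ' u hu, zero_mul]
  rw [sum_stepIns₁_mul_periodic_eq_sum_bonds M Lc hr w B hB x κ]
  -- right-hand side: lattice = box × period lattice; the lift reads the weight at the box point
  rw [tsum_sites_eq_sum_tsum (fine Lc M) hS, Fintype.sum_prod_type]
  refine Finset.sum_congr rfl fun y _ => ?_
  have hwrap : ∀ (m : Site (d + 1)) (κ' : Fin (d + 1)),
      w (wrapPt (fine Lc M) (translate (fine Lc M) (y : Site (d + 1)) m), κ') = w (y, κ') := fun m κ' => by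
    congr 2
    exact Subtype.ext (wrap_translate (fine Lc M) y.2 m)
  -- along the translates of `y` the family sum is finite
  obtain ⟨F, hF⟩ := exists_finset_translate (fine Lc M) (nearBox Lc (x : Site (d + 1))) (y : Site (d + 1))
  have hfin : ∀ κ' : Fin (d + 1), ∑' m : Site (d + 1), G κ' (translate (fine Lc M) (y : Site (d + 1)) m)
      = ∑ m ∈ F, G κ' (translate (fine Lc M) (y : Site (d + 1)) m) := fun κ' => tsum_eq_sum fun m hm => hG0 κ' _ (hF m hm)
  calc ∑ κ' : Fin (d + 1), w (y, κ') * ∑' m : Site (d + 1), G κ' (translate (fine Lc M) (y : Site (d + 1)) m)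
      = ∑ κ' : Fin (d + 1), ∑ m ∈ F, G κ' (translate (fine Lc M) (y : Site (d + 1)) m) * w (y, κ') := by
        refine Finset.sum_congr rfl fun κ' _ => ?_
        rw [hfin, mul_comm, Finset.sum_mul]
    _ = ∑ m ∈ F, ∑ κ' : Fin (d + 1), G κ' (translate (fine Lc M) (y : Site (d + 1)) m) * w (y, κ') := Finset.sum_comm
    _ = ∑' m : Site (d + 1), ∑ κ' : Fin (d + 1), G κ' (translate (fine Lc M) (y : Site (d + 1)) m) * w (y, κ') :=
        (tsum_eq_sum fun m hm => Finset.sum_eq_zero fun κ' _ => by rw [hG0 κ' _ (hF m hm), zero_mul]).symm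
    _ = ∑' m : Site (d + 1), ∑ κ' : Fin (d + 1),
          G κ' (translate (fine Lc M) (y : Site (d + 1)) m) * w (wrapPt (fine Lc M) (translate (fine Lc M) (y : Site (d + 1)) m), κ') := by
        simp only [hwrap]

end Step

end Summit.QuantumFields.BalabanUV.Beta.FP.TorusStepInsertionPeriodic

end
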